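import Summits.MatrixMultiplication.OmegaCensus.ThreeSetZ5Z5CoverKitE3Split
import HarnessLib

/-!
# Halving a column group of the three-margin cover program (kernel-budget bookkeeping)

ω-census `pub-omega`, family (b3), seat pub-omega-group gen 38.  Framing: lottery ticket; floor = certified bounds/negative ranges.
VALUE: bookkeeping for the `ℤ₅²` stage of the census cell `(1,9,12)@325` (design `HOME/pub-omega-group-g37/DESIGN-1-9-12.md`): a column
group whose `decide + kernel` exceeds a farm node's kernel memory cap (observed: one flagged row × 8 columns × 32 diagonals, ≈ 220k
enumeration nodes, '(kernel) excessive memory consumption' on one node while larger groups passed on others) is computed as two halves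
(`List.take` / `List.drop`) and recombined here with `coverGenE3_appendC`; NOT progress on ω.
-/

namespace Summit.MatrixMultiplication.OmegaCensus

namespace ZpZpDomino

/-- **Recombining the two halves of a column list** for a single flagged row vector. [folklore] -/
theorem coverGenE3_of_halves (tree : BTree) (exc : List (List (List ℕ))) (B : ℕ) (ws : List (List (List ℕ))) (dss : List (List ℕ))
    (R : List ℕ) (C Dlist : List (List ℕ)) (init : List ℕ) (offC offD : ℕ) (hR : tree.mem (polyBE B R) = true) (n : ℕ)
    (h1 : coverGenE3 tree exc B ws dss [R] (C.take n) Dlist init offC offD = true)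
    (h2 : coverGenE3 tree exc B ws dss [R] (C.drop n) Dlist init offC offD = true) :
    coverGenE3 tree exc B ws dss [R] C Dlist init offC offD = true := by
  rw [← List.take_append_drop n C, coverGenE3_appendC tree exc B ws dss R _ _ Dlist init offC offD hR, h1, h2]
  rfl

end ZpZpDomino

end Summit.MatrixMultiplication.OmegaCensus
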